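/-
Copyright: b2b-lace packet (enumeration shard A, gen 9).  The ℕ-CODED form of the end-point recursion for
self-avoiding walk counts (`SawCountRecursion`), evaluable by the kernel, and the TRANSFER THEOREM
`c_n(y; A) = Σ_j sawCode n j m (code y) ‖y‖₁ L · 2^j (d-m)^{(j)}`: one kernel evaluation per
(length, class, number of fresh coordinates) gives the count in EVERY dimension `d`.  No cell of the record
is touched; no fact; no `sorry`.
-/
import Literature.Probability.FitznerVanDerHofstad2017.SawCountRecursion
import HarnessLib

/-!
# A kernel-evaluable coding of the SAW end-point recursion, uniform in the dimension

CITATION HEADER (PLACEMENT v2). This module is part of a certified REPRODUCTION of: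
R. Fitzner, R. van der Hofstad, *Mean-field behavior for nearest-neighbor percolation in d > 10*,
Electron. J. Probab. 22 (2017), no. 43 [FvdH17]; *Generalized approach to the non-backtracking lace
expansion*, Probab. Theory Related Fields 169 (2017) [NoBLE17-I] (arXiv:1506.07977, 1506.07969).
Reproduces: the notebook input `nrSAW[n,d,x]` (SRW.nb §3: "number of n-step SAWs from 0 to x", polynomials
in `d`).  Here: the MACHINE.  `SawCountTables` holds the kernel-evaluated numbers.

## The coding

A lattice point `y ∈ ℤ^d` supported on the first `D` coordinates with `|y_i| < R` is coded by
`code D y = Σ_{i<D} (y_i + R) · B^i` (`R = 32`, `B = 64`; digits in `[1, 63]`); the avoidance set by the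
list of the codes of its elements; `‖y‖₁` is carried along.  `sawCode n j m c l1 L` runs the recursion of
`SawCountRecursion.sawCount` on codes with `m` ACTIVE coordinates, spending one of `j` FRESH coordinates
(canonically the coordinate `m`, weight `1` instead of `2(d-m)`) whenever the walk leaves the active ones
(`sawCount_succ_of_suppBelow`), and prunes by `n < 2j + ‖y‖₁` and parity.  The transfer theorem
**`sawCount_eq_sum_sawCode`** states, for `y`, `A` supported on the first `m ≤ d` coordinates inside the box,
`sawCount d n y A = Σ_{j ≤ n} sawCode n j m (code D y) ‖y‖₁ L · (2^j · (d-m)(d-m-1)⋯(d-m-j+1))`,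
so that **`card_sawWordsTo_eq_sum_sawCode`**: `#sawWordsTo d n x = Σ_{j ≤ n} N_j · 2^j (d-s)^{(j)}` for `x`
supported on the first `s ≤ d` coordinates, with `N_j = sawCode n j s (code (s+n) x) ‖x‖₁ []` INDEPENDENT of
`d` — the notebook's "polynomial in d", coefficient by coefficient, each `N_j` one `decide`.  The kernel runs
the variant `sawCodeF` (primitive `Nat.blt/ble/beq` tests, a hashed membership filter, no still-born children;
**`sawCodeF_eq`**, `sawCode_eq_sawCodeF`), about `1.7·10⁻⁴ s` per call on the farm.

## What is NOT here

No numeral table (see `SawCountTables`), no dimension fixed, no cell, no fact, no `sorry`.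

## References
* N. Madras, G. Slade, The Self-Avoiding Walk (1993), §1.1–1.2 [folklore recursion].
* R. Fitzner, R. van der Hofstad, SRW.nb (2015) §3, arXiv:1506.07977 anc. (the table reproduced downstream).
-/

namespace Literature.Probability.FitznerVanDerHofstad2017

open Finset Literature.Probability.LatticeModels Literature.Probability.Percolation

variable {d : ℕ}

/-! ### The coded recursion (kernel side: only `ℕ`, `Bool`, `List ℕ`) -/

/-- Half the base: coordinates are stored as `y_i + sawR`. [folklore] -/
def sawR : ℕ := 32

/-- The base of the positional code (`= 2 · sawR`). [folklore] -/
def sawB : ℕ := 64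

/-- List membership by `Nat.beq` (kernel-cheap). [folklore] -/
def memL (c : ℕ) : List ℕ → Bool
  | [] => false
  | a :: l => Nat.beq c a || memL c l

/-- The `i`-th base-`sawB` digit of `c`. [folklore] -/
def digitAt (c i : ℕ) : ℕ := c / sawB ^ i % sawB

/-- `stepSum m f = Σ_{i<m} f i`. [folklore] -/
def stepSum : ℕ → (ℕ → ℕ) → ℕ
  | 0, _ => 0
  | i + 1, f => stepSum i f + f i

/-- Zero steps left: the walk must sit at the origin (`‖y‖₁ = 0`, a new site) with no fresh coordinate
owed.  (The arithmetic test comes first: it is kernel-cheap, list membership is not.) [folklore] -/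
def sawBase (j _m c l1 : ℕ) (L : List ℕ) : ℕ :=
  bif decide (j + l1 = 0) then (bif memL c L then 0 else 1) else 0

/-- One step of the coded recursion: prune (`n+1 < 2j + ‖y‖₁` or wrong parity), reject a visited site, then
the `2m` steps inside the active coordinates and (if a fresh coordinate is still owed) the canonical step
into coordinate `m`. [folklore] -/
def sawStep (n : ℕ) (rec : ℕ → ℕ → ℕ → ℕ → List ℕ → ℕ) (j m c l1 : ℕ) (L : List ℕ) : ℕ :=
  bif decide (n + 1 < 2 * j + l1 ∨ (n + 1 + l1) % 2 = 1) then 0 else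
  bif memL c L then 0 else
    stepSum m (fun i =>
      let g := digitAt c i
      rec j m (c + sawB ^ i) (bif decide (sawR ≤ g) then l1 + 1 else l1 - 1) (c :: L) +
        rec j m (c - sawB ^ i) (bif decide (g ≤ sawR) then l1 + 1 else l1 - 1) (c :: L)) +
    (match j with
      | 0 => 0
      | j' + 1 => rec j' (m + 1) (c + sawB ^ m) (l1 + 1) (c :: L))

/-- **The coded SAW recursion** `sawCode n j m c l1 L`: number of `n`-step self-avoiding continuations from the
coded point `c` (with `‖·‖₁ = l1`, avoiding the coded set `L`, `m` active coordinates) to the origin that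
use exactly `j` fresh coordinates, each entered canonically. [folklore] -/
def sawCode : ℕ → ℕ → ℕ → ℕ → ℕ → List ℕ → ℕ
  | 0 => sawBase
  | n + 1 => sawStep n (sawCode n)

/-- The weight of `j` fresh coordinates out of `d - m` unused ones: `2^j (d-m)(d-m-1)⋯(d-m-j+1)`. [folklore] -/
def freshWeight (d m j : ℕ) : ℕ := 2 ^ j * (d - m).descFactorial j

/-! ### Elementary properties of the coded side -/

/-- `memL_iff` (coding bookkeeping). [folklore] -/
theorem memL_iff (c : ℕ) (L : List ℕ) : memL c L = true ↔ c ∈ L := by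
  induction L with
  | nil => simp [memL]
  | cons a l ih => simp [memL, ih, Nat.beq_eq]

/-- `stepSum_eq_sum` (coding bookkeeping). [folklore] -/
theorem stepSum_eq_sum (m : ℕ) (f : ℕ → ℕ) : stepSum m f = ∑ i ∈ range m, f i := by
  induction m with
  | zero => rfl
  | succ i ih => rw [stepSum, ih, sum_range_succ]

/-- `sawCode_of_memL` (coding bookkeeping). [folklore] -/
theorem sawCode_of_memL {n j m c l1 : ℕ} {L : List ℕ} (h : memL c L = true) : sawCode n j m c l1 L = 0 := by
  cases n with
  | zero => simp only [sawCode, sawBase, h, cond_true]; cases decide (j + l1 = 0) <;> rfl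
  | succ n =>
    simp only [sawCode, sawStep, h, cond_true]
    cases decide (n + 1 < 2 * j + l1 ∨ (n + 1 + l1) % 2 = 1) <;> rfl

/-- The prune is sound on ALL inputs: `sawCode n j m c l1 L = 0` if `n < 2j + l1` or `n + l1` is odd. [folklore] -/
theorem sawCode_prune {n j m c l1 : ℕ} {L : List ℕ} (h : n < 2 * j + l1 ∨ (n + l1) % 2 = 1) :
    sawCode n j m c l1 L = 0 := by
  cases n with
  | zero =>
    simp only [sawCode, sawBase, Bool.cond_decide]
    rw [if_neg (by omega)]
  | succ n =>
    simp only [sawCode, sawStep, Bool.cond_decide]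
    rw [if_pos h]

/-- `sawCode_zero_of_not_memL` (coding bookkeeping). [folklore] -/
theorem sawCode_zero_of_not_memL {j m c l1 : ℕ} {L : List ℕ} (h : memL c L = false) :
    sawCode 0 j m c l1 L = if j + l1 = 0 then 1 else 0 := by
  simp only [sawCode, sawBase, h, cond_false, Bool.cond_decide]

/-- `sawCode_succ_of_not_memL` (coding bookkeeping). [folklore] -/
theorem sawCode_succ_of_not_memL (n : ℕ) {j m c l1 : ℕ} {L : List ℕ} (h : memL c L = false)
    (hp : ¬ (n + 1 < 2 * j + l1 ∨ (n + 1 + l1) % 2 = 1)) :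
    sawCode (n + 1) j m c l1 L =
      (∑ i ∈ range m,
        (sawCode n j m (c + sawB ^ i) (if sawR ≤ digitAt c i then l1 + 1 else l1 - 1) (c :: L) +
          sawCode n j m (c - sawB ^ i) (if digitAt c i ≤ sawR then l1 + 1 else l1 - 1) (c :: L))) +
      (if j = 0 then 0 else sawCode n (j - 1) (m + 1) (c + sawB ^ m) (l1 + 1) (c :: L)) := by
  simp only [sawCode, sawStep, h, cond_false, Bool.cond_decide, if_neg hp, stepSum_eq_sum]
  cases j <;> simp

/-! ### The fast variant: hashed membership filter and no still-born children

`sawCodeF` computes the same numbers as `sawCode` (theorem `sawCodeF_eq`) but (i) keeps, next to the list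
`L` of visited codes, the bit mask `V` of their residues mod `sawP`, so that most membership queries are
answered by one `testBit`, and (ii) does not spawn the outward steps that the prune would kill at once. -/

/-- Modulus of the membership filter. [folklore] -/
def sawP : ℕ := 4093

/-- Filtered membership: look at the residue bit first. [folklore] -/
def memF (c V : ℕ) (L : List ℕ) : Bool := Nat.testBit V (c % sawP) && memL c L

/-- Fast base case (cf. `sawBase`; primitive `Nat.beq` instead of `decide`). [folklore] -/
def sawBaseF (j _m c l1 V : ℕ) (L : List ℕ) : ℕ :=
  bif Nat.beq (j + l1) 0 then (bif memF c V L then 0 else 1) else 0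

/-- Fast step (cf. `sawStep`; primitive `Nat.blt`/`Nat.ble`/`Nat.beq` tests): an outward step is spawned
only if `2j + ‖y‖₁ + 2 ≤ n + 1`. [folklore] -/
def sawStepF (n : ℕ) (rec : ℕ → ℕ → ℕ → ℕ → ℕ → List ℕ → ℕ) (j m c l1 V : ℕ) (L : List ℕ) : ℕ :=
  bif (Nat.blt (n + 1) (2 * j + l1) || Nat.beq ((n + 1 + l1) % 2) 1) then 0 else
  bif memF c V L then 0 else
    let V' := V ||| 2 ^ (c % sawP)
    let away := Nat.ble (2 * j + l1 + 2) (n + 1)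
    stepSum m (fun i =>
      let g := digitAt c i
      (bif (away || Nat.blt g sawR) then
          rec j m (c + sawB ^ i) (bif Nat.ble sawR g then l1 + 1 else l1 - 1) V' (c :: L) else 0) +
        (bif (away || Nat.blt sawR g) then
          rec j m (c - sawB ^ i) (bif Nat.ble g sawR then l1 + 1 else l1 - 1) V' (c :: L) else 0)) +
    (match j with
      | 0 => 0
      | j' + 1 => rec j' (m + 1) (c + sawB ^ m) (l1 + 1) V' (c :: L))

/-- **The fast coded SAW recursion** (what the kernel actually runs in `SawCountTables`). [folklore] -/
def sawCodeF : ℕ → ℕ → ℕ → ℕ → ℕ → ℕ → List ℕ → ℕ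
  | 0 => sawBaseF
  | n + 1 => sawStepF n (sawCodeF n)

/-- The filter invariant: every listed code has its residue bit set. [folklore] -/
def FInv (V : ℕ) (L : List ℕ) : Prop := ∀ a ∈ L, Nat.testBit V (a % sawP) = true

/-- `fInv_nil` (coding bookkeeping). [folklore] -/
theorem fInv_nil : FInv 0 [] := fun a h => by simp at h

/-- `FInv.cons` (coding bookkeeping). [folklore] -/
theorem FInv.cons {V : ℕ} {L : List ℕ} (h : FInv V L) (c : ℕ) : FInv (V ||| 2 ^ (c % sawP)) (c :: L) := by
  intro a ha
  rw [Nat.testBit_or]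
  rcases List.mem_cons.1 ha with rfl | ha
  · rw [Nat.testBit_two_pow_self, Bool.or_true]
  · rw [h a ha, Bool.true_or]

/-- `memF_eq` (coding bookkeeping). [folklore] -/
theorem memF_eq {V : ℕ} {L : List ℕ} (h : FInv V L) (c : ℕ) : memF c V L = memL c L := by
  unfold memF
  cases hb : Nat.testBit V (c % sawP)
  · cases hm : memL c L
    · rfl
    · exact absurd (h c ((memL_iff c L).1 hm)) (by rw [hb]; exact Bool.false_ne_true)
  · exact Bool.true_and _

/-- `natBlt_eq_decide` (coding bookkeeping). [folklore] -/
theorem natBlt_eq_decide (a b : ℕ) : Nat.blt a b = decide (a < b) := Bool.eq_iff_iff.2 (by simp [Nat.blt_eq])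

/-- `natBle_eq_decide` (coding bookkeeping). [folklore] -/
theorem natBle_eq_decide (a b : ℕ) : Nat.ble a b = decide (a ≤ b) := Bool.eq_iff_iff.2 (by simp [Nat.ble_eq])

/-- `natBeq_eq_decide` (coding bookkeeping). [folklore] -/
theorem natBeq_eq_decide (a b : ℕ) : Nat.beq a b = decide (a = b) := Bool.eq_iff_iff.2 (by simp [Nat.beq_eq])

/-- **`sawCodeF = sawCode`** under the filter invariant (in particular `sawCodeF n j m c l1 0 [] =
sawCode n j m c l1 []`). [folklore] -/
theorem sawCodeF_eq (n : ℕ) :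
    ∀ (j m c l1 V : ℕ) (L : List ℕ), FInv V L → sawCodeF n j m c l1 V L = sawCode n j m c l1 L := by
  induction n with
  | zero =>
    intro j m c l1 V L hV
    simp only [sawCodeF, sawCode, sawBaseF, sawBase, memF_eq hV, natBeq_eq_decide]
  | succ n ih =>
    intro j m c l1 V L hV
    simp only [sawCodeF, sawCode, sawStepF, sawStep, memF_eq hV, natBlt_eq_decide, natBle_eq_decide,
      natBeq_eq_decide, ← Bool.decide_or]
    cases decide (n + 1 < 2 * j + l1 ∨ (n + 1 + l1) % 2 = 1)
    · cases memL c L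
      · simp only [cond_false]
        have hV' := hV.cons c
        congr 1
        · congr 1
          funext i
          congr 1
          · by_cases hb : 2 * j + l1 + 2 ≤ n + 1 ∨ digitAt c i < sawR
            · rw [decide_eq_true hb, cond_true, ih _ _ _ _ _ _ hV']
            · rw [decide_eq_false hb, cond_false, sawCode_prune]
              rw [not_or] at hb
              left
              simp only [Bool.cond_decide]
              rw [if_pos (by omega)]
              omega
          · by_cases hb : 2 * j + l1 + 2 ≤ n + 1 ∨ sawR < digitAt c i
            · rw [decide_eq_true hb, cond_true, ih _ _ _ _ _ _ hV']
            · rw [decide_eq_false hb, cond_false, sawCode_prune]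
              rw [not_or] at hb
              left
              simp only [Bool.cond_decide]
              rw [if_pos (by omega)]
              omega
        · cases j
          · rfl
          · exact ih _ _ _ _ _ _ hV'
      · rfl
    · rfl

/-- The closed form used by the tables: `sawCode n j m c l1 [] = sawCodeF n j m c l1 0 []`. [folklore] -/
theorem sawCode_eq_sawCodeF (n j m c l1 : ℕ) : sawCode n j m c l1 [] = sawCodeF n j m c l1 0 [] :=
  (sawCodeF_eq n j m c l1 0 [] fInv_nil).symm

/-! ### The code of a lattice point -/

/-- The `i`-th coordinate of `y : ℤ^d` as a function on `ℕ` (`0` beyond `d`). [folklore] -/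
def coordAt (y : Site d) (i : ℕ) : ℤ := if h : i < d then y ⟨i, h⟩ else 0

/-- The stored digit `y_i + R` (as a natural number). [folklore] -/
def digitOf (y : Site d) (i : ℕ) : ℕ := (coordAt y i + sawR).toNat

/-- The positional code of `y` on `D` digits. [folklore] -/
def code (D : ℕ) (y : Site d) : ℕ := ∑ i ∈ range D, digitOf y i * sawB ^ i

/-- `y` lies in the box `|y_i| < R`. [folklore] -/
def InBox (y : Site d) : Prop := ∀ i : Fin d, (y i).natAbs < sawR

/-- `coordAt_of_lt` (coding bookkeeping). [folklore] -/
theorem coordAt_of_lt (y : Site d) {i : ℕ} (h : i < d) : coordAt y i = y ⟨i, h⟩ := by simp [coordAt, h]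

/-- `coordAt_of_le` (coding bookkeeping). [folklore] -/
theorem coordAt_of_le (y : Site d) {i : ℕ} (h : d ≤ i) : coordAt y i = 0 := by
  simp [coordAt, show ¬ i < d by omega]

/-- `natAbs_coordAt_lt` (coding bookkeeping). [folklore] -/
theorem natAbs_coordAt_lt {y : Site d} (hy : InBox y) (i : ℕ) : (coordAt y i).natAbs < sawR := by
  by_cases h : i < d
  · rw [coordAt_of_lt y h]; exact hy ⟨i, h⟩
  · rw [coordAt_of_le y (by omega)]; simp [sawR]

/-- `digitOf_lt` (coding bookkeeping). [folklore] -/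
theorem digitOf_lt {y : Site d} (hy : InBox y) (i : ℕ) : digitOf y i < sawB := by
  have := natAbs_coordAt_lt hy i
  simp only [digitOf, sawB, sawR] at *
  omega

/-- `coordAt_add_bvec` (coding bookkeeping). [folklore] -/
theorem coordAt_add_bvec (y : Site d) {k : ℕ} (hk : k < d) (i : ℕ) :
    coordAt (y + bvec d k) i = coordAt y i + if i = k then 1 else 0 := by
  by_cases h : i < d
  · simp [coordAt_of_lt _ h, bvec]
  · have : i ≠ k := by omega
    simp [coordAt_of_le _ (show d ≤ i by omega), this]

/-- `coordAt_sub_bvec` (coding bookkeeping). [folklore] -/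
theorem coordAt_sub_bvec (y : Site d) {k : ℕ} (hk : k < d) (i : ℕ) :
    coordAt (y - bvec d k) i = coordAt y i - if i = k then 1 else 0 := by
  by_cases h : i < d
  · simp [coordAt_of_lt _ h, bvec]
  · have : i ≠ k := by omega
    simp [coordAt_of_le _ (show d ≤ i by omega), this]

/-- Base-`B` digit extraction from a positional sum with digits `< B`. [folklore] -/
theorem digitAt_sum (D : ℕ) (g : ℕ → ℕ) (hg : ∀ i, g i < sawB) {k : ℕ} (hk : k < D) :
    digitAt (∑ i ∈ range D, g i * sawB ^ i) k = g k := by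
  have hB : 0 < sawB := by simp [sawB]
  -- low part < B^k
  have hlow : ∀ t, ∑ i ∈ range t, g i * sawB ^ i < sawB ^ t := by
    intro t
    induction t with
    | zero => simp
    | succ t ih =>
      rw [sum_range_succ, pow_succ]
      have := hg t
      nlinarith [Nat.pow_pos hB (n := t)]
  -- split the sum at k and k+1
  obtain ⟨e, rfl⟩ : ∃ e, D = k + 1 + e := ⟨D - (k + 1), by omega⟩
  rw [sum_range_add, sum_range_succ]
  have hhigh : ∑ i ∈ range e, g (k + 1 + i) * sawB ^ (k + 1 + i) =
      sawB ^ (k + 1) * ∑ i ∈ range e, g (k + 1 + i) * sawB ^ i := by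
    rw [mul_sum]
    refine sum_congr rfl fun i _ => ?_
    rw [pow_add]; ring
  rw [hhigh, digitAt]
  set low := ∑ i ∈ range k, g i * sawB ^ i with hlow_def
  set high := ∑ i ∈ range e, g (k + 1 + i) * sawB ^ i
  have h1 : (low + g k * sawB ^ k + sawB ^ (k + 1) * high) / sawB ^ k = g k + sawB * high := by
    have : low + g k * sawB ^ k + sawB ^ (k + 1) * high = low + sawB ^ k * (g k + sawB * high) := by
      rw [pow_succ]; ring
    rw [this, Nat.add_mul_div_left _ _ (Nat.pow_pos hB), Nat.div_eq_of_lt (hlow k), zero_add]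
  rw [h1, Nat.add_mul_mod_self_left, Nat.mod_eq_of_lt (hg k)]

/-- `digitAt_code` (coding bookkeeping). [folklore] -/
theorem digitAt_code {y : Site d} (hy : InBox y) {D k : ℕ} (hk : k < D) :
    digitAt (code D y) k = digitOf y k :=
  digitAt_sum D (digitOf y) (digitOf_lt hy) hk

/-- `code (y + e_k) = code y + B^k`. [folklore] -/
theorem code_add_bvec {y : Site d} (hy : InBox y) {D k : ℕ} (hkD : k < D) (hkd : k < d) :
    code D (y + bvec d k) = code D y + sawB ^ k := by
  have hdig : ∀ i, digitOf (y + bvec d k) i = digitOf y i + if i = k then 1 else 0 := by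
    intro i
    have hc := natAbs_coordAt_lt hy i
    simp only [digitOf, coordAt_add_bvec y hkd]
    split_ifs <;> (simp only [sawR, Nat.cast_ofNat] at hc ⊢; omega)
  simp only [code, hdig, add_mul, sum_add_distrib, ite_mul, one_mul, zero_mul, sum_ite_eq', mem_range,
    hkD, if_true]

/-- `code (y - e_k) + B^k = code y`. [folklore] -/
theorem code_sub_bvec {y : Site d} (hy : InBox y) {D k : ℕ} (hkD : k < D) (hkd : k < d) :
    code D (y - bvec d k) = code D y - sawB ^ k := by
  have hdig : ∀ i, digitOf y i = digitOf (y - bvec d k) i + if i = k then 1 else 0 := by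
    intro i
    have hc := natAbs_coordAt_lt hy i
    simp only [digitOf, coordAt_sub_bvec y hkd]
    split_ifs <;> (simp only [sawR, Nat.cast_ofNat] at hc ⊢; omega)
  have : code D y = code D (y - bvec d k) + sawB ^ k := by
    simp only [code, hdig, add_mul, sum_add_distrib, ite_mul, one_mul, zero_mul, sum_ite_eq', mem_range,
      hkD, if_true]
  omega

/-- The code is injective on box points supported on the first `D` coordinates. [folklore] -/
theorem code_inj {y z : Site d} (hy : InBox y) (hz : InBox z) {D : ℕ} (hyD : SuppBelow D y)
    (hzD : SuppBelow D z) (h : code D y = code D z) : y = z := by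
  funext i
  by_cases hi : (i : ℕ) < D
  · have h1 := digitAt_code hy hi
    have h2 := digitAt_code hz hi
    rw [h] at h1
    rw [h1] at h2
    have hcy := natAbs_coordAt_lt hy i
    have hcz := natAbs_coordAt_lt hz i
    simp only [digitOf, coordAt_of_lt _ i.isLt, sawR] at h2 hcy hcz
    have : (y ⟨i, i.isLt⟩) = z ⟨i, i.isLt⟩ := by omega
    simpa using this
  · rw [hyD i (by omega), hzD i (by omega)]

/-- `‖y + e_k‖₁` from the stored digit: up if `y_k ≥ 0`, down otherwise. [folklore] -/
theorem l1Norm_add_bvec {y : Site d} (hy : InBox y) {D k : ℕ} (hkD : k < D) (hkd : k < d) :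
    l1Norm (y + bvec d k) = if sawR ≤ digitAt (code D y) k then l1Norm y + 1 else l1Norm y - 1 := by
  rw [digitAt_code hy hkD]
  have hsplit : ∀ z : Site d, l1Norm z = (z ⟨k, hkd⟩).natAbs + ∑ i ∈ univ.erase ⟨k, hkd⟩, (z i).natAbs :=
    fun z => (add_sum_erase _ _ (mem_univ _)).symm
  have hrest : ∑ i ∈ univ.erase (⟨k, hkd⟩ : Fin d), ((y + bvec d k) i).natAbs =
      ∑ i ∈ univ.erase (⟨k, hkd⟩ : Fin d), (y i).natAbs := by
    refine sum_congr rfl fun i hi => ?_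
    have hi' : (i : ℕ) ≠ k := fun h => ne_of_mem_erase hi (Fin.ext h)
    simp only [Pi.add_apply, bvec, if_neg hi', add_zero]
  have hc := hy ⟨k, hkd⟩
  rw [hsplit (y + bvec d k), hsplit y, hrest]
  simp only [digitOf, coordAt_of_lt _ hkd, Pi.add_apply, bvec, sawR] at hc ⊢
  split_ifs <;> omega

/-- `‖y - e_k‖₁` from the stored digit: up if `y_k ≤ 0`, down otherwise. [folklore] -/
theorem l1Norm_sub_bvec {y : Site d} (hy : InBox y) {D k : ℕ} (hkD : k < D) (hkd : k < d) :
    l1Norm (y - bvec d k) = if digitAt (code D y) k ≤ sawR then l1Norm y + 1 else l1Norm y - 1 := by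
  rw [digitAt_code hy hkD]
  have hsplit : ∀ z : Site d, l1Norm z = (z ⟨k, hkd⟩).natAbs + ∑ i ∈ univ.erase ⟨k, hkd⟩, (z i).natAbs :=
    fun z => (add_sum_erase _ _ (mem_univ _)).symm
  have hrest : ∑ i ∈ univ.erase (⟨k, hkd⟩ : Fin d), ((y - bvec d k) i).natAbs =
      ∑ i ∈ univ.erase (⟨k, hkd⟩ : Fin d), (y i).natAbs := by
    refine sum_congr rfl fun i hi => ?_
    have hi' : (i : ℕ) ≠ k := fun h => ne_of_mem_erase hi (Fin.ext h)
    simp only [Pi.sub_apply, bvec, if_neg hi', sub_zero]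
  have hc := hy ⟨k, hkd⟩
  rw [hsplit (y - bvec d k), hsplit y, hrest]
  simp only [digitOf, coordAt_of_lt _ hkd, Pi.sub_apply, bvec, sawR] at hc ⊢
  split_ifs <;> omega

/-- A step into an unused coordinate raises `‖·‖₁` by one. [folklore] -/
theorem l1Norm_add_bvec_fresh {m : ℕ} {y : Site d} (hy : SuppBelow m y) (hmd : m < d) :
    l1Norm (y + bvec d m) = l1Norm y + 1 := by
  have hsplit : ∀ z : Site d, l1Norm z = (z ⟨m, hmd⟩).natAbs + ∑ i ∈ univ.erase ⟨m, hmd⟩, (z i).natAbs :=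
    fun z => (add_sum_erase _ _ (mem_univ _)).symm
  have hrest : ∑ i ∈ univ.erase (⟨m, hmd⟩ : Fin d), ((y + bvec d m) i).natAbs =
      ∑ i ∈ univ.erase (⟨m, hmd⟩ : Fin d), (y i).natAbs := by
    refine sum_congr rfl fun i hi => ?_
    have hi' : (i : ℕ) ≠ m := fun h => ne_of_mem_erase hi (Fin.ext h)
    simp only [Pi.add_apply, bvec, if_neg hi', add_zero]
  rw [hsplit (y + bvec d m), hsplit y, hrest, Pi.add_apply, hy ⟨m, hmd⟩ le_rfl]
  simp [bvec, add_comm]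

/-- In-box is preserved by the steps when there is margin. [folklore] -/
theorem inBox_add_bvec {y : Site d} (hy : ∀ i : Fin d, (y i).natAbs + 1 < sawR) (k : ℕ) :
    InBox (y + bvec d k) := fun i => by
  have := hy i
  simp only [Pi.add_apply, bvec]
  split_ifs <;> omega

/-- `inBox_sub_bvec` (coding bookkeeping). [folklore] -/
theorem inBox_sub_bvec {y : Site d} (hy : ∀ i : Fin d, (y i).natAbs + 1 < sawR) (k : ℕ) :
    InBox (y - bvec d k) := fun i => by
  have := hy i
  simp only [Pi.sub_apply, bvec]
  split_ifs <;> omega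

/-- `margin_add_bvec` (coding bookkeeping). [folklore] -/
theorem margin_add_bvec {n : ℕ} {y : Site d} (hy : ∀ i : Fin d, (y i).natAbs + (n + 1) < sawR) (k : ℕ) :
    ∀ i : Fin d, ((y + bvec d k) i).natAbs + n < sawR := fun i => by
  have := hy i
  simp only [Pi.add_apply, bvec]
  split_ifs <;> omega

/-- `margin_sub_bvec` (coding bookkeeping). [folklore] -/
theorem margin_sub_bvec {n : ℕ} {y : Site d} (hy : ∀ i : Fin d, (y i).natAbs + (n + 1) < sawR) (k : ℕ) :
    ∀ i : Fin d, ((y - bvec d k) i).natAbs + n < sawR := fun i => by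
  have := hy i
  simp only [Pi.sub_apply, bvec]
  split_ifs <;> omega

/-! ### The weights -/

/-- `freshWeight_zero` (coding bookkeeping). [folklore] -/
theorem freshWeight_zero (d m : ℕ) : freshWeight d m 0 = 1 := by simp [freshWeight]

/-- `2(d-m) · 2^j (d-m-1)^{(j)} = 2^{j+1} (d-m)^{(j+1)}`. [folklore] -/
theorem freshWeight_succ (d m j : ℕ) : 2 * (d - m) * freshWeight d (m + 1) j = freshWeight d m (j + 1) := by
  unfold freshWeight
  rcases Nat.eq_zero_or_pos (d - m) with h | h
  · rw [h, Nat.zero_descFactorial_succ]; ring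
  · obtain ⟨e, he⟩ : ∃ e, d - m = e + 1 := ⟨d - m - 1, by omega⟩
    rw [he, show d - (m + 1) = e by omega, Nat.succ_descFactorial_succ]; ring

/-! ### The transfer theorem -/

/-- **Transfer**: the coded recursion computes `sawCount`, uniformly in `d`.  For `y ∉`-checked, `A`
supported on the first `m ≤ d` coordinates, inside the box with margin `n`, `L` listing the codes of `A`:
`sawCount d n y A = Σ_{j ≤ n} sawCode n j m (code D y) ‖y‖₁ L · 2^j (d-m)^{(j)}`. [folklore] -/
theorem sawCount_eq_sum_sawCode (D : ℕ) (n : ℕ) :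
    ∀ (m : ℕ) (y : Site d) (A : Finset (Site d)) (L : List ℕ),
      m ≤ d → SuppBelow m y → (∀ z ∈ A, SuppBelow m z) → m + n ≤ D →
      (∀ i : Fin d, (y i).natAbs + n < sawR) → (∀ z ∈ A, InBox z) →
      (∀ c, memL c L = true ↔ c ∈ A.image (code D)) →
      sawCount d n y A = ∑ j ∈ range (n + 1), sawCode n j m (code D y) (l1Norm y) L * freshWeight d m j := by
  induction n with
  | zero =>
    intro m y A L hmd hy hA hmD hbox hAbox hL
    have hyBox : InBox y := fun i => by have := hbox i; omega
    rw [sum_range_one, freshWeight_zero, mul_one]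
    by_cases hyA : y ∈ A
    · rw [sawCount_of_mem hyA, sawCode_of_memL]
      exact (hL _).2 (mem_image_of_mem _ hyA)
    · have hc : memL (code D y) L = false := by
        rw [Bool.eq_false_iff, ne_eq, hL, mem_image]
        rintro ⟨z, hz, hzy⟩
        exact hyA (code_inj (hAbox z hz) hyBox ((hA z hz).mono (by omega)) (hy.mono (by omega)) hzy ▸ hz)
      rw [sawCount_zero_of_not_mem hyA, sawCode_zero_of_not_memL hc, zero_add]
      simp only [l1Norm_eq_zero_iff]
  | succ n ih =>
    intro m y A L hmd hy hA hmD hbox hAbox hL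
    have hyBox : InBox y := fun i => by have := hbox i; omega
    have hmD' : m < D := by omega
    by_cases hyA : y ∈ A
    · rw [sawCount_of_mem hyA]
      symm
      refine sum_eq_zero fun j _ => ?_
      rw [sawCode_of_memL ((hL _).2 (mem_image_of_mem _ hyA)), zero_mul]
    have hc : memL (code D y) L = false := by
      rw [Bool.eq_false_iff, ne_eq, hL, mem_image]
      rintro ⟨z, hz, hzy⟩
      exact hyA (code_inj (hAbox z hz) hyBox ((hA z hz).mono (by omega)) (hy.mono (by omega)) hzy ▸ hz)
    -- data of the children
    set A' := insert y A with hA'def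
    set L' := code D y :: L with hL'def
    have hA' : ∀ z ∈ A', SuppBelow m z := by
      intro z hz
      rcases mem_insert.1 hz with rfl | hz
      exacts [hy, hA z hz]
    have hA'box : ∀ z ∈ A', InBox z := by
      intro z hz
      rcases mem_insert.1 hz with rfl | hz
      exacts [hyBox, hAbox z hz]
    have hL' : ∀ c, memL c L' = true ↔ c ∈ A'.image (code D) := by
      intro c
      rw [hL'def, hA'def, image_insert, mem_insert, memL, Bool.or_eq_true, Nat.beq_eq, hL]
    -- the semantic children
    let p : ℕ → ℕ → ℕ := fun i j =>
      sawCode n j m (code D (y + bvec d i)) (l1Norm (y + bvec d i)) L'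
    let q : ℕ → ℕ → ℕ := fun i j =>
      sawCode n j m (code D (y - bvec d i)) (l1Norm (y - bvec d i)) L'
    let f : ℕ → ℕ := fun j => sawCode n j (m + 1) (code D y + sawB ^ m) (l1Norm y + 1) L'
    -- IH for the active children
    have hP : ∀ i ∈ range m,
        sawCount d n (y + bvec d i) A' = ∑ j ∈ range (n + 1), p i j * freshWeight d m j := by
      intro i hi
      rw [mem_range] at hi
      exact ih m _ A' L' hmd (hy.add_bvec hi) hA' (by omega) (margin_add_bvec hbox i) hA'box hL'
    have hQ : ∀ i ∈ range m,
        sawCount d n (y - bvec d i) A' = ∑ j ∈ range (n + 1), q i j * freshWeight d m j := by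
      intro i hi
      rw [mem_range] at hi
      exact ih m _ A' L' hmd (hy.sub_bvec hi) hA' (by omega) (margin_sub_bvec hbox i) hA'box hL'
    -- the key identity per `j`: the coded step equals the (semantic) active children + the coded fresh child
    have key : ∀ j, sawCode (n + 1) j m (code D y) (l1Norm y) L =
        (∑ i ∈ range m, (p i j + q i j)) + (if j = 0 then 0 else f (j - 1)) := by
      intro j
      by_cases hp : n + 1 < 2 * j + l1Norm y ∨ (n + 1 + l1Norm y) % 2 = 1
      · rw [sawCode_prune hp]
        symm
        rw [Nat.add_eq_zero_iff]
        refine ⟨sum_eq_zero fun i hi => ?_, ?_⟩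
        · rw [mem_range] at hi
          have hid : i < d := by omega
          have h1 := l1Norm_sub_stepVec (y + bvec d i) (⟨i, hid⟩, true)
          have h2 := l1Norm_sub_stepVec (y - bvec d i) (⟨i, hid⟩, false)
          rw [stepVec_true] at h1
          rw [stepVec_false, sub_neg_eq_add] at h2
          have e1 : y + bvec d i - bvec d i = y := add_sub_cancel_right y _
          have e2 : y - bvec d i + bvec d i = y := sub_add_cancel y _
          simp only [e1, e2] at h1 h2
          show sawCode n j m _ _ L' + sawCode n j m _ _ L' = 0
          rw [sawCode_prune (by omega), sawCode_prune (by omega)]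
        · split_ifs with hj
          · rfl
          · exact sawCode_prune (by omega)
      · rw [sawCode_succ_of_not_memL n hc hp]
        congr 1
        refine sum_congr rfl fun i hi => ?_
        rw [mem_range] at hi
        have hid : i < d := by omega
        have hiD : i < D := by omega
        show _ = sawCode n j m _ _ L' + sawCode n j m _ _ L'
        rw [code_add_bvec hyBox hiD hid, code_sub_bvec hyBox hiD hid, l1Norm_add_bvec hyBox hiD hid,
          l1Norm_sub_bvec hyBox hiD hid]
    -- assemble
    rw [sawCount_succ_of_suppBelow hmd n hy hA hyA]
    have hR : ∑ j ∈ range (n + 1 + 1), sawCode (n + 1) j m (code D y) (l1Norm y) L * freshWeight d m j =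
        (∑ j ∈ range (n + 1 + 1), (∑ i ∈ range m, (p i j + q i j)) * freshWeight d m j) +
          ∑ j ∈ range (n + 1 + 1), (if j = 0 then 0 else f (j - 1)) * freshWeight d m j := by
      rw [← sum_add_distrib]
      exact sum_congr rfl fun j _ => by rw [key, add_mul]
    rw [hR]
    congr 1
    · -- active coordinates
      have hlast : (∑ i ∈ range m, (p i (n + 1) + q i (n + 1))) * freshWeight d m (n + 1) = 0 := by
        rw [sum_eq_zero, zero_mul]
        intro i _
        show sawCode n (n + 1) m _ _ L' + sawCode n (n + 1) m _ _ L' = 0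
        rw [sawCode_prune (by omega), sawCode_prune (by omega)]
      rw [sum_range_succ, hlast, add_zero,
        sum_congr rfl fun i hi => congrArg₂ (· + ·) (hP i hi) (hQ i hi)]
      simp_rw [sum_mul]
      rw [sum_comm (s := range (n + 1))]
      refine sum_congr rfl fun i _ => ?_
      rw [← sum_add_distrib]
      refine sum_congr rfl fun j _ => ?_
      ring
    · -- the fresh coordinate
      have hY : ∑ j ∈ range (n + 1 + 1), (if j = 0 then 0 else f (j - 1)) * freshWeight d m j =
          ∑ j ∈ range (n + 1), f j * freshWeight d m (j + 1) := by
        rw [sum_range_succ']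
        simp
      rw [hY]
      simp_rw [← freshWeight_succ d m]
      by_cases hmd2 : m < d
      · rw [ih (m + 1) _ A' L' hmd2 hy.add_bvec_succ (fun z hz => (hA' z hz).mono (Nat.le_succ m))
            (by omega) (margin_add_bvec hbox m) hA'box hL', code_add_bvec hyBox hmD' hmd2,
          l1Norm_add_bvec_fresh hy hmd2, mul_sum]
        refine sum_congr rfl fun j _ => ?_
        ring
      · have h0 : d - m = 0 := by omega
        simp [h0]

/-- **The SAW counts are polynomials in `d`, coefficientwise kernel-evaluable.**  For `x` supported on the
first `s ≤ d` coordinates with `|x_i| + n < 32`: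
`#sawWordsTo d n x = Σ_{j ≤ n} sawCode n j s (code (s + n) x) ‖x‖₁ [] · 2^j (d - s)^{(j)}`
(reproduces the shape of SRW.nb §3 `nrSAW[n,d,x]`). [folklore] -/
theorem card_sawWordsTo_eq_sum_sawCode (n s : ℕ) (hsd : s ≤ d) (x : Site d) (hx : SuppBelow s x)
    (hbox : ∀ i : Fin d, (x i).natAbs + n < sawR) :
    (sawWordsTo d n x).card =
      ∑ j ∈ range (n + 1), sawCode n j s (code (s + n) x) (l1Norm x) [] * freshWeight d s j := by
  rw [card_sawWordsTo_eq_sawCount]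
  exact sawCount_eq_sum_sawCode (s + n) n s x ∅ [] hsd hx (by simp) le_rfl hbox (by simp)
    (fun c => by simp [memL])

end Literature.Probability.FitznerVanDerHofstad2017
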